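import Literature.MathematicalPhysics.QuantumFieldTheory.Balaban1983to89.B5AverageCurlStokes
import Literature.MathematicalPhysics.QuantumFieldTheory.Balaban1983to89.B5Prop11Lower

/-!
# T⁴ programme, spine node NE2 (U1a), tier B support row B4.c — A BLOCK POINCARÉ INEQUALITY FOR 0-FORMS on the blocks
# `B^k(y)` of [B5] (1.6)/(1.20): `‖f − Π′f‖² ≤ 4d·⟨f, Δf⟩`, `Π′ = n^d·Q′ᴴQ′` the block-mean projector of the scalar averaging `Q′_k`

NE2 formalisation swarm `b2b-balaban-t4-ne2-formalise-*`, leaf 09, file 1 (support row B4.c of `t4/formal/NE2/LEAVES.md`: the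
`U = 1` scalar-layer inputs of the gauge-term row B4.b).  The gauge term of Bałaban's background operator
([Balaban1985BackgroundPropagators] (3.26) p.395 «Δ_a = Δ + DRD* + Q*aQ», R = (3.25) built from `G′ = (Δ′_a)⁻¹`,
(3.24) «Δ′_a = Δ^η_U + Q′*aQ′») lives on the SCALAR layer: 0-forms on the fine torus `T_η`, the scalar block averaging `Q′`
([Balaban1984PropagatorsI] (1.20), tree: `B5Block118.QsOp`) and the scalar Laplacian `Δ = Σ_ν ∂_ν^*∂_ν` (tree:
`B5Action121.LapS`).  At `U = 1` the k-uniform invertibility of `Δ′_a = Δ + a′Q′*Q′` rests on ONE inequality, proved here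
in position space and without eigenvalue analysis (the 0-form counterpart of `Support/BalabanBlockPoincare`, which treats
1-forms on King's `R`-blocks):

 * §1 `ℓ²` tools on vectors (`nsq` of `B5Prop11Lower`): `nsq (Σ_{i∈s} g_i) ≤ |s|·Σ nsq g_i`, `nsq (f + g) ≤ 2nsq f + 2nsq g`,
   translations `transS v f = f(· + v)` preserve `nsq`;
 * §2 ONE-STEP AND STRAIGHT-LINE DEFECTS: `nsq (f(· + t e_ν) − f) ≤ t²·nsq (f(· + e_ν) − f)` and, for `t ≤ n`,
   `≤ nsq (∂_ν f)` with `∂_ν = n(S_ν − 1)` (`B5Action121.sdiff … (n : ℂ)`); along the in-block offset `ιj = Σ_ν j_ν e_ν`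
   (`B5Block118.iota`): `nsq (f(· + ιj) − f) ≤ d·Σ_ν nsq (∂_ν f)` (telescoping over the directions);
 * §3 THE BLOCK-MEAN PROJECTOR `PiS n M = n^d·Q′ᴴQ′` (`(Π′f)(x) = ` the mean of `f` over the block of `x`), the box translation
   average `boxAvg f = n^{−d}Σ_j f(· + ιj)`, the KEY IDENTITY `(boxAvg f − Π′f)(n·y + j₀) = (Q′(f(· + ιj₀) − f))(y)` (block mean =
   box average seen from the block corner), the block Cauchy–Schwarz `nsq (Q′g) ≤ n^{−d}·nsq g`, and
   **`nsq_sub_PiS_le`**: `nsq (f − Π′f) ≤ 4d·Σ_ν nsq (∂_ν f)` (`= 4d·⟨f, Δf⟩`), UNIFORMLY in `n = η⁻¹` and in the torus.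

HONEST FRAMING (T4-DAG p. 1).  [folklore] lattice calculus about the cell's typed `U = 1` objects; statements / constants OURS;
nothing printed is a hypothesis.  `U = 1`, FIXED FINITE torus, scalar layer; a SUPPORT input of row B4.b, NOT B4, NOT [B9]
(3.23)–(3.26) as printed; NE2 NOT proved; spine 0/9 unchanged; NOT infinite volume / mass gap / Clay / summit progress.  HONEST
DEPENDENCY: continuum YM on T⁴ ⇐ BetaPertH ∧ nine spine estimates (0/9 proved); BetaPertH ⇐ (D1) ∧ (D4) ∧ CAP+tail; G-an2-4
gates asym, D1 and NE2/3/4.  ABSOLUTE RULE kept; zero sorries.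
-/

noncomputable section

open scoped BigOperators ComplexConjugate Matrix Matrix.Norms.L2Operator
open Finset

namespace Summit.QuantumFields.BalabanUV.T4Continuum.ScalarBlockPoincare

open Literature.MathematicalPhysics.QuantumFieldTheory.Balaban1983to89.B5Prop11Plancherel
open Literature.MathematicalPhysics.QuantumFieldTheory.Balaban1983to89.B5Prop11Lower (nsq nsq_nonneg star_dotProduct_self)
open Literature.MathematicalPhysics.QuantumFieldTheory.Balaban1983to89.B5Action121 (sdiff LapS sdiff_mulVec)
open Literature.MathematicalPhysics.QuantumFieldTheory.Balaban1983to89.B5Block118 (tstep tstep_zero tstep_succ up iota bpt QsOp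
  QsOp_mulVec)
open Literature.MathematicalPhysics.QuantumFieldTheory.Balaban1983to89.B5Blocks16 (bpt_bijective sum_blocks blockOf blockOf_bpt)
open Literature.MathematicalPhysics.QuantumFieldTheory.Balaban1983to89.B5AverageCurlStokes (sum_blocks_real)

variable {d : ℕ}

/-! ## §1 `ℓ²` tools on vectors -/

section VecTools

variable {m : Type*} [Fintype m]

/-- `nsq (Σ_{i∈s} g_i) ≤ |s|·Σ_{i∈s} nsq g_i` (Cauchy–Schwarz). [folklore] -/
theorem nsq_sum_le {σ : Type*} (s : Finset σ) (g : σ → m → ℂ) :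
    nsq (∑ i ∈ s, g i) ≤ s.card * ∑ i ∈ s, nsq (g i) := by
  unfold nsq
  calc ∑ x, ‖(∑ i ∈ s, g i) x‖ ^ 2 ≤ ∑ x, (s.card * ∑ i ∈ s, ‖g i x‖ ^ 2) := by
        refine Finset.sum_le_sum fun x _ => ?_
        rw [Finset.sum_apply]
        calc ‖∑ i ∈ s, g i x‖ ^ 2 ≤ (∑ i ∈ s, ‖g i x‖) ^ 2 :=
              pow_le_pow_left₀ (norm_nonneg _) (norm_sum_le _ _) 2
          _ ≤ s.card * ∑ i ∈ s, ‖g i x‖ ^ 2 := sq_sum_le_card_mul_sum_sq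
    _ = s.card * ∑ i ∈ s, ∑ x, ‖g i x‖ ^ 2 := by rw [← Finset.mul_sum, Finset.sum_comm]

/-- `nsq (f + g) ≤ 2·nsq f + 2·nsq g`. [folklore] -/
theorem nsq_add_le (f g : m → ℂ) : nsq (f + g) ≤ 2 * nsq f + 2 * nsq g := by
  have h := nsq_sum_le (Finset.univ : Finset (Fin 2)) (fun i => if i = 0 then f else g)
  simp only [Fin.sum_univ_two, Fin.isValue, if_true, one_ne_zero, if_false, Finset.card_univ, Fintype.card_fin] at h
  push_cast at h
  linarith

/-- `nsq (c • f) = ‖c‖²·nsq f`. [folklore] -/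
theorem nsq_smul (c : ℂ) (f : m → ℂ) : nsq (c • f) = ‖c‖ ^ 2 * nsq f := by
  unfold nsq; rw [Finset.mul_sum]
  exact Finset.sum_congr rfl fun x _ => by rw [Pi.smul_apply, smul_eq_mul, norm_mul, mul_pow]

/-- `nsq (f − g) = nsq (g − f)`. [folklore] -/
theorem nsq_sub_comm (f g : m → ℂ) : nsq (f - g) = nsq (g - f) := by
  unfold nsq; exact Finset.sum_congr rfl fun x _ => by rw [Pi.sub_apply, Pi.sub_apply, norm_sub_rev]

end VecTools

/-! ## §2 Translations, one-step and straight-line defects -/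

section Transl

variable (N : Fin d → ℕ) [hN : ∀ μ, NeZero (N μ)]

/-- translation of a 0-form: `(T_v f)(x) = f(x + v)`. [folklore] -/
def transS (v : Tor N) (f : Tor N → ℂ) : Tor N → ℂ := fun x => f (x + v)

omit hN in
/-- `T_0 = 1`. [folklore] -/
theorem transS_zero (f : Tor N → ℂ) : transS N 0 f = f := by funext x; simp [transS]

omit hN in
/-- `T_{u+v} = T_u T_v`. [folklore] -/
theorem transS_add (u v : Tor N) (f : Tor N → ℂ) : transS N (u + v) f = transS N u (transS N v f) := by
  funext x; simp only [transS, add_assoc]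

omit hN in
/-- `T_v` is linear: differences. [folklore] -/
theorem transS_sub (v : Tor N) (f g : Tor N → ℂ) : transS N v (f - g) = transS N v f - transS N v g := rfl

/-- `T_v` preserves `nsq` (a permutation of the sites). [folklore] -/
theorem nsq_transS (v : Tor N) (f : Tor N → ℂ) : nsq (transS N v f) = nsq f := by
  unfold nsq transS
  exact Fintype.sum_equiv (Equiv.addRight v) _ _ fun x => rfl

/-- `∂_ν f = c·(T_{e_ν} f − f)`. [folklore] -/
theorem sdiff_mulVec_eq (c : ℂ) (ν : Fin d) (f : Tor N → ℂ) :
    sdiff N c ν *ᵥ f = c • (transS N (unitVec N ν) f - f) := by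
  funext x; rw [sdiff_mulVec]; rfl

omit hN in
/-- telescoping along a straight line: `T_{te_ν} f − f = Σ_{s<t} T_{se_ν}(T_{e_ν} f − f)`. [folklore] -/
theorem transS_tstep_sub (ν : Fin d) (t : ℕ) (f : Tor N → ℂ) :
    transS N (tstep N ν t) f - f = ∑ s ∈ Finset.range t, transS N (tstep N ν s) (transS N (unitVec N ν) f - f) := by
  induction t with
  | zero => rw [tstep_zero, transS_zero, sub_self, Finset.range_zero, Finset.sum_empty]
  | succ t ih =>
    rw [Finset.sum_range_succ, ← ih, transS_sub, ← transS_add, ← tstep_succ]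
    abel

/-- `nsq (T_{te_ν} f − f) ≤ t²·nsq (T_{e_ν} f − f)`. [folklore] -/
theorem nsq_transS_tstep_sub_le (ν : Fin d) (t : ℕ) (f : Tor N → ℂ) :
    nsq (transS N (tstep N ν t) f - f) ≤ (t : ℝ) ^ 2 * nsq (transS N (unitVec N ν) f - f) := by
  rw [transS_tstep_sub]
  refine (nsq_sum_le _ _).trans ?_
  rw [Finset.card_range]
  have e : ∀ s ∈ Finset.range t, nsq (transS N (tstep N ν s) (transS N (unitVec N ν) f - f)) = nsq (transS N (unitVec N ν) f - f) :=
    fun s _ => nsq_transS N _ _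
  rw [Finset.sum_congr rfl e, Finset.sum_const, Finset.card_range, nsmul_eq_mul, sq]
  ring_nf
  exact le_rfl

/-- for `t ≤ n`: `nsq (T_{te_ν} f − f) ≤ nsq (∂_ν f)` with `∂_ν = n(S_ν − 1)`. [folklore] -/
theorem nsq_transS_tstep_sub_le_sdiff (n : ℕ) (ν : Fin d) {t : ℕ} (ht : t ≤ n) (f : Tor N → ℂ) :
    nsq (transS N (tstep N ν t) f - f) ≤ nsq (sdiff N (n : ℂ) ν *ᵥ f) := by
  refine (nsq_transS_tstep_sub_le N ν t f).trans ?_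
  rw [sdiff_mulVec_eq, nsq_smul, Complex.norm_natCast]
  exact mul_le_mul_of_nonneg_right (pow_le_pow_left₀ (Nat.cast_nonneg t) (by exact_mod_cast ht) 2) (nsq_nonneg _)

end Transl

/-! ## §2b Telescoping over the directions: the in-block offsets `ιj` -/

section Offsets

variable (N : Fin d → ℕ) [hN : ∀ μ, NeZero (N μ)]

omit hN in
/-- telescoping along a sequence of translations: `T_{W_k} f − f = Σ_{i<k} T_{W_i}(T_{v_i} f − f)`, `W_k = Σ_{i<k} v_i`. [folklore] -/
theorem transS_partialSum_sub (v : ℕ → Tor N) (k : ℕ) (f : Tor N → ℂ) :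
    transS N (∑ i ∈ Finset.range k, v i) f - f
      = ∑ i ∈ Finset.range k, transS N (∑ m ∈ Finset.range i, v m) (transS N (v i) f - f) := by
  induction k with
  | zero => rw [Finset.range_zero, Finset.sum_empty, Finset.sum_empty, transS_zero, sub_self]
  | succ k ih =>
    rw [Finset.sum_range_succ, Finset.sum_range_succ, ← ih, transS_sub, ← transS_add]
    abel

/-- hence `nsq (T_{W_k} f − f) ≤ k·Σ_{i<k} nsq (T_{v_i} f − f)`. [folklore] -/
theorem nsq_transS_partialSum_sub_le (v : ℕ → Tor N) (k : ℕ) (f : Tor N → ℂ) :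
    nsq (transS N (∑ i ∈ Finset.range k, v i) f - f) ≤ k * ∑ i ∈ Finset.range k, nsq (transS N (v i) f - f) := by
  rw [transS_partialSum_sub]
  refine (nsq_sum_le _ _).trans ?_
  rw [Finset.card_range]
  refine mul_le_mul_of_nonneg_left (le_of_eq (Finset.sum_congr rfl fun i _ => nsq_transS N _ _)) (Nat.cast_nonneg k)

end Offsets

section OffsetsFine

variable (n : ℕ) [NeZero n] (M : Fin d → ℕ) [hM : ∀ μ, NeZero (M μ)]

/-- the direction-`i` leg of the offset `ιj` as an `ℕ`-indexed sequence (zero beyond `d`). [folklore] -/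
def legOf (j : Fin d → Fin n) (i : ℕ) : Tor (fine n M) :=
  if h : i < d then tstep (fine n M) ⟨i, h⟩ (j ⟨i, h⟩ : ℕ) else 0

omit [NeZero n] hM in
/-- `ιj = Σ_ν j_ν e_ν` as the full partial sum of its legs. [folklore] -/
theorem iota_eq_sum_legOf (j : Fin d → Fin n) : iota n M j = ∑ i ∈ Finset.range d, legOf n M j i := by
  rw [← Fin.sum_univ_eq_sum_range (fun i => legOf n M j i) d]
  have e : ∀ ν : Fin d, legOf n M j (ν : ℕ) = tstep (fine n M) ν (j ν : ℕ) := fun ν => by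
    simp only [legOf, ν.is_lt, dif_pos]
  rw [Finset.sum_congr rfl fun ν _ => e ν]
  funext μ
  rw [Finset.sum_apply, Finset.sum_eq_single μ (fun ν _ hν => by simp [tstep, Ne.symm hν]) (fun h => absurd (Finset.mem_univ μ) h)]
  simp [tstep, iota]

/-- **the offset defect**: `nsq (f(· + ιj) − f) ≤ d·Σ_ν nsq (∂_ν f)` for every in-block offset `j ∈ {0,…,n−1}^d`
(`∂_ν = n(S_ν − 1)`). [folklore] -/
theorem nsq_transS_iota_sub_le (j : Fin d → Fin n) (f : Tor (fine n M) → ℂ) :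
    nsq (transS (fine n M) (iota n M j) f - f) ≤ d * ∑ ν, nsq (sdiff (fine n M) (n : ℂ) ν *ᵥ f) := by
  rw [iota_eq_sum_legOf]
  refine (nsq_transS_partialSum_sub_le (fine n M) (legOf n M j) d f).trans ?_
  refine mul_le_mul_of_nonneg_left ?_ (Nat.cast_nonneg d)
  rw [← Fin.sum_univ_eq_sum_range (fun i => nsq (transS (fine n M) (legOf n M j i) f - f)) d]
  refine Finset.sum_le_sum fun ν _ => ?_
  have e : legOf n M j (ν : ℕ) = tstep (fine n M) ν (j ν : ℕ) := by simp only [legOf, ν.is_lt, dif_pos]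
  rw [e]
  exact nsq_transS_tstep_sub_le_sdiff (fine n M) n ν (j ν).is_lt.le f

end OffsetsFine

/-! ## §3 The block-mean projector, the box average, and the Poincaré inequality -/

section Blocks

variable (n : ℕ) [NeZero n] (M : Fin d → ℕ) [hM : ∀ μ, NeZero (M μ)]

/-- **THE BLOCK-MEAN PROJECTOR ON 0-FORMS** `Π′ = n^d·Q′ᴴQ′` (`Q′ = Q′_k` of (1.20), `n = η⁻¹ = L^k`): `(Π′f)(x)` = the mean of `f`
over the block of `x`; in Bałaban's weighted conventions `Π′ = Q′*Q′`, `Q′* = n^dQ′ᴴ` (cf. `B5DeltaA169.QvAdj`). [folklore] -/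
def PiS : Matrix (Tor (fine n M)) (Tor (fine n M)) ℂ := ((n : ℂ) ^ d) • ((QsOp n M)ᴴ * QsOp n M)

/-- the entries of `Q′`: `Q′(y, x) = n^{−d}·[x ∈ B^k(y)]`. [cite: Balaban1984PropagatorsI, (1.20) p.20] [folklore] -/
theorem QsOp_apply_blockOf (y : Tor M) (x : Tor (fine n M)) :
    QsOp n M y x = if blockOf n M x = y then 1 / (n : ℂ) ^ d else 0 := by
  set e := Equiv.ofBijective _ (bpt_bijective n M) with he
  have hx : x = bpt n M (e.symm x).1 (e.symm x).2 := (e.apply_symm_apply x).symm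
  have hblk : blockOf n M x = (e.symm x).1 := rfl
  have key : ∀ j : Fin d → Fin n, (x = bpt n M y j) ↔ (y = (e.symm x).1 ∧ j = (e.symm x).2) := by
    intro j
    constructor
    · intro h
      have h2 : e (y, j) = e (e.symm x) := by rw [e.apply_symm_apply]; exact h.symm
      have h3 := e.injective h2
      exact ⟨(congrArg Prod.fst h3), (congrArg Prod.snd h3)⟩
    · rintro ⟨h1, h2⟩
      rw [h1, h2]; exact hx
  unfold QsOp
  simp_rw [key]
  by_cases hy : blockOf n M x = y
  · rw [if_pos hy, hblk] at *
    rw [← hy]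
    simp
  · rw [if_neg hy]
    refine Finset.sum_eq_zero fun j _ => ?_
    rw [if_neg]
    rintro ⟨h1, _⟩
    exact hy (by rw [hblk, h1])

/-- `(Q′ᴴ g)(x) = n^{−d}·g(block of x)` (every fine site lies in exactly one block). [folklore] -/
theorem QsOp_conjTranspose_mulVec (g : Tor M → ℂ) (x : Tor (fine n M)) :
    ((QsOp n M)ᴴ *ᵥ g) x = 1 / (n : ℂ) ^ d * g (blockOf n M x) := by
  simp only [Matrix.mulVec, dotProduct, Matrix.conjTranspose_apply, QsOp_apply_blockOf]
  rw [Finset.sum_eq_single (blockOf n M x) (fun y _ hy => by rw [if_neg (Ne.symm hy), star_zero, zero_mul])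
    (fun h => absurd (Finset.mem_univ _) h)]
  rw [if_pos rfl]
  simp

/-- `(Π′f)(x) = (Q′f)(block of x)` = the block mean. [folklore] -/
theorem PiS_mulVec (f : Tor (fine n M) → ℂ) (x : Tor (fine n M)) :
    (PiS n M *ᵥ f) x = (QsOp n M *ᵥ f) (blockOf n M x) := by
  have hn : ((n : ℂ) ^ d) ≠ 0 := pow_ne_zero _ (by exact_mod_cast NeZero.ne n)
  rw [PiS, Matrix.smul_mulVec, ← Matrix.mulVec_mulVec, Pi.smul_apply, QsOp_conjTranspose_mulVec, smul_eq_mul]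
  field_simp

/-- block Cauchy–Schwarz: `nsq (Q′g) ≤ n^{−d}·nsq g`. [folklore] -/
theorem nsq_QsOp_mulVec_le (g : Tor (fine n M) → ℂ) : nsq (QsOp n M *ᵥ g) ≤ ((n : ℝ) ^ d)⁻¹ * nsq g := by
  have hn : (0 : ℝ) < (n : ℝ) ^ d := pow_pos (by exact_mod_cast Nat.pos_of_ne_zero (NeZero.ne n)) d
  have hcard : (Fintype.card (Fin d → Fin n) : ℝ) = (n : ℝ) ^ d := by
    rw [Fintype.card_fun, Fintype.card_fin, Fintype.card_fin]; push_cast; ring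
  unfold nsq
  rw [sum_blocks_real n M (fun x => ‖g x‖ ^ 2), Finset.mul_sum]
  refine Finset.sum_le_sum fun y _ => ?_
  rw [QsOp_mulVec, norm_mul, mul_pow]
  have h1 : ‖1 / (n : ℂ) ^ d‖ ^ 2 = (((n : ℝ) ^ d)⁻¹) ^ 2 := by
    rw [norm_div, norm_one, norm_pow, Complex.norm_natCast, one_div]
  rw [h1]
  have h2 : ‖∑ j : Fin d → Fin n, g (bpt n M y j)‖ ^ 2 ≤ (n : ℝ) ^ d * ∑ j : Fin d → Fin n, ‖g (bpt n M y j)‖ ^ 2 := by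
    calc _ ≤ (∑ j : Fin d → Fin n, ‖g (bpt n M y j)‖) ^ 2 := pow_le_pow_left₀ (norm_nonneg _) (norm_sum_le _ _) 2
      _ ≤ (Finset.univ : Finset (Fin d → Fin n)).card * ∑ j : Fin d → Fin n, ‖g (bpt n M y j)‖ ^ 2 := sq_sum_le_card_mul_sum_sq
      _ = _ := by rw [Finset.card_univ, hcard]
  calc (((n : ℝ) ^ d)⁻¹) ^ 2 * ‖∑ j : Fin d → Fin n, g (bpt n M y j)‖ ^ 2
      ≤ (((n : ℝ) ^ d)⁻¹) ^ 2 * ((n : ℝ) ^ d * ∑ j : Fin d → Fin n, ‖g (bpt n M y j)‖ ^ 2) :=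
        mul_le_mul_of_nonneg_left h2 (by positivity)
    _ = ((n : ℝ) ^ d)⁻¹ * ∑ j : Fin d → Fin n, ‖g (bpt n M y j)‖ ^ 2 := by field_simp

/-- `nsq (Π′f) = n^d·nsq (Q′f)` (each block mean is repeated `n^d` times). [folklore] -/
theorem nsq_PiS_mulVec_eq (f : Tor (fine n M) → ℂ) : nsq (PiS n M *ᵥ f) = (n : ℝ) ^ d * nsq (QsOp n M *ᵥ f) := by
  have hcard : (Fintype.card (Fin d → Fin n) : ℝ) = (n : ℝ) ^ d := by
    rw [Fintype.card_fun, Fintype.card_fin, Fintype.card_fin]; push_cast; ring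
  unfold nsq
  rw [sum_blocks_real n M (fun x => ‖(PiS n M *ᵥ f) x‖ ^ 2), Finset.mul_sum]
  refine Finset.sum_congr rfl fun y _ => ?_
  simp only [PiS_mulVec, blockOf_bpt, Finset.sum_const, Finset.card_univ, nsmul_eq_mul, hcard]

/-- `nsq (Π′f) ≤ nsq f`. [folklore] -/
theorem nsq_PiS_mulVec_le (f : Tor (fine n M) → ℂ) : nsq (PiS n M *ᵥ f) ≤ nsq f := by
  have hn : (0 : ℝ) < (n : ℝ) ^ d := pow_pos (by exact_mod_cast Nat.pos_of_ne_zero (NeZero.ne n)) d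
  rw [nsq_PiS_mulVec_eq]
  calc (n : ℝ) ^ d * nsq (QsOp n M *ᵥ f) ≤ (n : ℝ) ^ d * (((n : ℝ) ^ d)⁻¹ * nsq f) :=
        mul_le_mul_of_nonneg_left (nsq_QsOp_mulVec_le n M f) hn.le
    _ = nsq f := by field_simp

/-- `⟨f, Π′f⟩ = nsq (Π′f)` (so `Π′ ≥ 0`; it is in fact the orthogonal projector onto block-constant functions). [folklore] -/
theorem form_PiS (f : Tor (fine n M) → ℂ) : star f ⬝ᵥ (PiS n M *ᵥ f) = ((nsq (PiS n M *ᵥ f) : ℝ) : ℂ) := by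
  rw [nsq_PiS_mulVec_eq, PiS, Matrix.smul_mulVec, dotProduct_smul,
    Literature.MathematicalPhysics.QuantumFieldTheory.Balaban1983to89.B5Action121.form_gram_rect, star_dotProduct_self,
    smul_eq_mul]
  push_cast
  ring

/-- `⟨f, Δf⟩ = Σ_ν nsq (∂_ν f)` as a real number cast to `ℂ`. [folklore] -/
theorem form_LapS_eq (c : ℂ) (f : Tor (fine n M) → ℂ) :
    star f ⬝ᵥ (LapS (fine n M) c *ᵥ f) = ((∑ ν, nsq (sdiff (fine n M) c ν *ᵥ f) : ℝ) : ℂ) := by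
  have h : star f ⬝ᵥ (LapS (fine n M) c *ᵥ f) = ∑ ν, star (sdiff (fine n M) c ν *ᵥ f) ⬝ᵥ (sdiff (fine n M) c ν *ᵥ f) := by
    simp only [LapS, Matrix.sum_mulVec, dotProduct_sum, ← Matrix.mulVec_mulVec, Matrix.dotProduct_mulVec, ← Matrix.star_mulVec]
  rw [h, Complex.ofReal_sum]
  exact Finset.sum_congr rfl fun ν _ => star_dotProduct_self _

/-- the BOX TRANSLATION AVERAGE `boxAvg f = n^{−d}·Σ_{j∈[0,n)^d} f(· + ιj)`. [folklore] -/
def boxAvg (f : Tor (fine n M) → ℂ) : Tor (fine n M) → ℂ :=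
  ((n : ℂ) ^ d)⁻¹ • ∑ j : Fin d → Fin n, transS (fine n M) (iota n M j) f

/-- `nsq (f − boxAvg f) ≤ d·Σ_ν nsq (∂_ν f)`. [folklore] -/
theorem nsq_sub_boxAvg_le (f : Tor (fine n M) → ℂ) :
    nsq (f - boxAvg n M f) ≤ d * ∑ ν, nsq (sdiff (fine n M) (n : ℂ) ν *ᵥ f) := by
  have hn : (0 : ℝ) < (n : ℝ) ^ d := pow_pos (by exact_mod_cast Nat.pos_of_ne_zero (NeZero.ne n)) d
  have hnc : ((n : ℂ) ^ d) ≠ 0 := pow_ne_zero _ (by exact_mod_cast NeZero.ne n)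
  have hcard : (Fintype.card (Fin d → Fin n) : ℝ) = (n : ℝ) ^ d := by
    rw [Fintype.card_fun, Fintype.card_fin, Fintype.card_fin]; push_cast; ring
  set L : ℝ := d * ∑ ν, nsq (sdiff (fine n M) (n : ℂ) ν *ᵥ f) with hL
  -- `f − boxAvg f = n^{−d}·Σ_j (f − T_{ιj} f)`
  have e : f - boxAvg n M f = ((n : ℂ) ^ d)⁻¹ • ∑ j : Fin d → Fin n, (f - transS (fine n M) (iota n M j) f) := by
    rw [boxAvg, Finset.sum_sub_distrib, Finset.sum_const, Finset.card_univ, smul_sub]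
    have hc : (Fintype.card (Fin d → Fin n)) • f = ((n : ℂ) ^ d) • f := by
      rw [Fintype.card_fun, Fintype.card_fin, Fintype.card_fin, ← Nat.cast_smul_eq_nsmul ℂ]; push_cast; rfl
    rw [hc, smul_smul, inv_mul_cancel₀ hnc, one_smul]
  rw [e, nsq_smul, norm_inv, norm_pow, Complex.norm_natCast]
  have h1 := nsq_sum_le (Finset.univ : Finset (Fin d → Fin n)) (fun j => f - transS (fine n M) (iota n M j) f)
  rw [Finset.card_univ, hcard] at h1
  have h2 : ∑ j : Fin d → Fin n, nsq (f - transS (fine n M) (iota n M j) f) ≤ ∑ _j : Fin d → Fin n, L :=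
    Finset.sum_le_sum fun j _ => by rw [nsq_sub_comm]; exact nsq_transS_iota_sub_le n M j f
  rw [Finset.sum_const, Finset.card_univ, nsmul_eq_mul, hcard] at h2
  calc (((n : ℝ) ^ d)⁻¹) ^ 2 * nsq (∑ j : Fin d → Fin n, (f - transS (fine n M) (iota n M j) f))
      ≤ (((n : ℝ) ^ d)⁻¹) ^ 2 * ((n : ℝ) ^ d * ((n : ℝ) ^ d * L)) :=
        mul_le_mul_of_nonneg_left (h1.trans (mul_le_mul_of_nonneg_left h2 hn.le)) (by positivity)
    _ = L := by field_simp

/-- THE KEY IDENTITY: `(boxAvg f − Π′f)(n·y + j₀) = (Q′(T_{ιj₀} f − f))(y)` — the box average at a site of offset `j₀` minus its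
block mean is the block average of the `ιj₀`-translation defect. [folklore] -/
theorem boxAvg_sub_PiS_apply (f : Tor (fine n M) → ℂ) (y : Tor M) (j₀ : Fin d → Fin n) :
    boxAvg n M f (bpt n M y j₀) - (PiS n M *ᵥ f) (bpt n M y j₀)
      = (QsOp n M *ᵥ (transS (fine n M) (iota n M j₀) f - f)) y := by
  rw [PiS_mulVec, blockOf_bpt, QsOp_mulVec, QsOp_mulVec, boxAvg]
  simp only [Pi.smul_apply, Finset.sum_apply, Pi.sub_apply, transS, smul_eq_mul, one_div, Finset.sum_sub_distrib, mul_sub]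
  congr 1
  congr 1
  refine Finset.sum_congr rfl fun j _ => ?_
  simp only [bpt]
  rw [add_right_comm]

/-- `nsq (boxAvg f − Π′f) ≤ d·Σ_ν nsq (∂_ν f)`. [folklore] -/
theorem nsq_boxAvg_sub_PiS_le (f : Tor (fine n M) → ℂ) :
    nsq (boxAvg n M f - PiS n M *ᵥ f) ≤ d * ∑ ν, nsq (sdiff (fine n M) (n : ℂ) ν *ᵥ f) := by
  have hn : (0 : ℝ) < (n : ℝ) ^ d := pow_pos (by exact_mod_cast Nat.pos_of_ne_zero (NeZero.ne n)) d
  have hcard : (Fintype.card (Fin d → Fin n) : ℝ) = (n : ℝ) ^ d := by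
    rw [Fintype.card_fun, Fintype.card_fin, Fintype.card_fin]; push_cast; ring
  set L : ℝ := d * ∑ ν, nsq (sdiff (fine n M) (n : ℂ) ν *ᵥ f) with hL
  have e1 : nsq (boxAvg n M f - PiS n M *ᵥ f)
      = ∑ j₀ : Fin d → Fin n, nsq (QsOp n M *ᵥ (transS (fine n M) (iota n M j₀) f - f)) := by
    unfold nsq
    rw [sum_blocks_real n M (fun x => ‖(boxAvg n M f - PiS n M *ᵥ f) x‖ ^ 2), Finset.sum_comm]
    refine Finset.sum_congr rfl fun j₀ _ => Finset.sum_congr rfl fun y _ => ?_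
    rw [Pi.sub_apply, boxAvg_sub_PiS_apply]
  rw [e1]
  calc ∑ j₀ : Fin d → Fin n, nsq (QsOp n M *ᵥ (transS (fine n M) (iota n M j₀) f - f))
      ≤ ∑ _j₀ : Fin d → Fin n, ((n : ℝ) ^ d)⁻¹ * L :=
        Finset.sum_le_sum fun j₀ _ => (nsq_QsOp_mulVec_le n M _).trans
          (mul_le_mul_of_nonneg_left (nsq_transS_iota_sub_le n M j₀ f) (inv_nonneg.mpr hn.le))
    _ = L := by rw [Finset.sum_const, Finset.card_univ, nsmul_eq_mul, hcard]; field_simp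

/-- **THE BLOCK POINCARÉ INEQUALITY FOR 0-FORMS**: `nsq (f − Π′f) ≤ 4d·Σ_ν nsq (∂_ν f)` (`= 4d·⟨f, Δf⟩`), uniformly in
`n = η⁻¹` and in the torus. [folklore] -/
theorem nsq_sub_PiS_le (f : Tor (fine n M) → ℂ) :
    nsq (f - PiS n M *ᵥ f) ≤ 4 * d * ∑ ν, nsq (sdiff (fine n M) (n : ℂ) ν *ᵥ f) := by
  have e : f - PiS n M *ᵥ f = (f - boxAvg n M f) + (boxAvg n M f - PiS n M *ᵥ f) := by abel
  rw [e]
  refine (nsq_add_le _ _).trans ?_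
  have h1 := nsq_sub_boxAvg_le n M f
  have h2 := nsq_boxAvg_sub_PiS_le n M f
  linarith

end Blocks

end Summit.QuantumFields.BalabanUV.T4Continuum.ScalarBlockPoincare

end
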